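import Mathlib
import HarnessLib
import HarnessLib.Audit
import Summits.CriticalPhenomena.Statement
import Literature.Probability.RandomPlanarGeometry.ChordalCurveFamily
import Literature.Probability.RandomPlanarGeometry.ConformalRestriction
import Literature.Probability.LatticeModels.PolylineWinding
import Literature.Probability.RandomPlanarGeometry.CaratheodoryHalfPlaneProofs
import Summits.CriticalPhenomena.SAWScalingLimit.Theorems.SAWLoopFugacityFlowAvoidanceDeterminesLaw
import HarnessLib.Audit.Status.Attr

/-!
Route: SAWTensorRG

# Route SAWTensorRG — certified n = 0 tensor RG delivers conformally invariant avoidance ratios;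
lattice-exact restriction + LSW03 (proved in tree) force SLE(8/3)

It suffices to show X = (CA) ∧ (S) ∧ (R), realising card certified-tensor-rg-n0-vertex-model with
its ENGINE (rigorous tensor-network RG at the n = 0 complex vertex tensor of the ℤ² SAW,
Kennedy–Rychkov style, quarter-turn Newton map) pointed at the one lattice quantity the engine
computes and the identification needs: hull-AVOIDANCE RATIOS Z_δ(Ω'; a, b)/Z_δ(Ω; a, b) = P_δ(γ ⊆ cl
Ω'), which are ratios of two contractions of the SAME translation-invariant 3-state tensor (loops
cancel at n = 0, the open path's phase is fixed by the Hopf turning lemma, boundary lattice factors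
at a, b cancel because Ω, Ω' agree there).
 (CA) ConformalAvoidance: for hull-subdomain pairs (D ⊇ D') agreeing near the marked points, the
avoidance probability converges along the full filter δ → 0+ to a number that is the same for every
endpoint approximation and for every conformally equivalent configuration (g : D → E with boundary
values a ↦ a', b ↦ b', g(D') = E') — existence + CONFORMAL INVARIANCE, value-free (the RG's fixed
point + impurity/boundary sector is exactly what is supposed to produce this; no exponent needs to
be certified exactly).
 (S) SimpleSubseqLimits: subsequential weak limits of the critical SAW laws are carried by simple
chords meeting ∂D only at a, b (shared with SAWLoopFugacityFlow).
 (R) RestrictionOfLimit: the lattice-exact restriction identity passes to any full limit family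
(shared with SAWConfRestriction).
With eventual tightness, 'avoidance determines the law' and the glue LimitGlue these give a chordal,
conformally covariant, restriction family carried by simple curves; Lawler–Schramm–Werner's chordal
restriction theorem — PROVED in the tree
(Literature.Probability.RandomPlanarGeometry.LawlerSchrammWerner2003_holds) — makes every P D the
chordal SLE_(8/3) law, and the value Φ'_A(0)^(5/8) comes out a posteriori instead of being an input.
The engine's first theorem-shaped milestone, the D4 ⇒ O(2) statement IsotropicCorrelationLength (the
inverse-correlation-length norm of the subcritical ℤ² SAW becomes Euclidean at x_c), is filed as the
rank-3 crux: it is where the quarter-turn does its work and the cheapest place to learn whether the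
engine turns at all.
Lean: `ConformalAvoidance ∧ SimpleSubseqLimits ∧ RestrictionOfLimit`

## Assembly
Light glue, checked to elaborate in the planner sketch (cone repair 2026-08-15, rc 0 with the
route's light imports): LimitGlue (fed the PROVED tree theorems CurveClass.polishSpace_holds and
MarkedDomain.exists_isChordalUniformizing_holds) yields P chordal with (lim) and (conf);
RestrictionOfLimit gives (restr); SimpleSubseqLimits applied to the full limit along s_n = 1/(n+1)
(an endpoint approximation exists by EndpointApproxExists; P D is a probability measure by
IsChordal) gives (simple); the Lawler–Schramm–Werner chordal restriction characterisation, carried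
BY NAME as the support item LSWCharacterisation (:=
Literature.Probability.RandomPlanarGeometry.LawlerSchrammWerner2003, PROVED in tree as
LawlerSchrammWerner2003_holds; kept as an item so that the route module imports the 13-module
statement file ConformalRestriction.lean and not the 460-module proof development), gives IsSLELaw
(8/3) D (P D) for every D, i.e. P D = preWienerMeasure.map Γ for a chordal SLE_(8/3) curve Γ; moving
the test integrals of (lim) along integral_map (measurability of γ ↦ γ.curve is
SAW.aemeasurable_curve) turns TendstoLaw … id (P D) into ConvergesInLawToSLE (8/3) D — the two-line
argument of SAW.IsScalingLimitFamily.sawScalingLimit, inlined so that SAWScalingLimitFamily (and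
through it Percolation/CLE6) is not imported. This is the deciding theorem `closes`; the item
Assembly is the same implication with LSW03 as its first antecedent, provable with the route file's
own imports. IsotropicCorrelationLength and TurningInvariance are engine milestones, deliberately
not consumed by the glue.

Rationale: WHY THIS LINE. Mechanism (card certified-tensor-rg-n0-vertex-model; Nienhuis1982, BloteNienhuis1989,
arXiv:cond-mat/0210548 for the vertex-model dictionary; KennedyRychkov2022,
EbelKennedyRychkov2025Rotations, EbelKennedyRychkov2025 = arXiv:2506.03247 for the rigorous tensor
RG): the x_c-weighted ℤ² SAW is exactly a 3-state complex vertex model with turn phases e^(±iπ/8)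
(closed loops weigh 2cos(π/2) = 0; the open path's phase is fixed by the boundary,
TurningInvariance), so every avoidance ratio is a ratio of contractions of one local D4-covariant
tensor with a deleted region; a certified fixed point of an untruncated RG map composed with the
quarter-turn (eigenvalue 1 of the stretch directions becomes −1, Newton converges: arXiv:2408.10312
§2.5) plus control of the impurity/boundary sector would deliver existence and covariance of these
ratios' limits. What is imported: tensor-network renormalisation and computer-assisted RG
(mathematical physics / interval arithmetic: arXiv:2506.03247 Thm 10 certifies the high-T basin and
names the critical fixed point as the long-range goal, §4), conformal restriction
(LawlerSchrammWerner2003Restriction, in tree and proved), weak-convergence machinery (Prokhorov,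
Literature.Probability.LatticeModels.exists_tendstoLaw_of_isTightMeasureSet). Planner's correction
of the card: its R3 handed the covariant correlators to the 5/8-martingale identification, which
needs the boundary and bulk exponents 5/8 and 5/48 EXACTLY — something interval arithmetic cannot
certify; the restriction rigidity of LSW03 needs only conformal INVARIANCE of value-free avoidance
ratios plus simplicity, and then forces α = 5/8 itself, so the route is re-based on the proved cone
fact LawlerSchrammWerner2003. What the line does that sibling routes do not:
SAWConfRestriction/SAWRestrictionRigidity want the covariant limit family from an abstract continuum
rigidity theorem (Rigidity, stmt-1368: 'no technique known') or leave (conf) undecomposed;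
SAWLoopFugacityFlow wants the VALUE d^(5/8) by continuation in n from Ising; here covariance is to
be CONSTRUCTED at n = 0 directly, integrability-free, by a technique class empty in this programme,
and the negatives index (stmt-0772, all-δ tightness) is avoided by using the eventual form
EventualTight.

RANKED CRUXES. #2 ConformalAvoidance (crux) — card N1+N2+N3 in typed lattice form — for Dobrushin D
⊇ D' (same marked points, agreeing in balls around a and b), E ⊇ E' likewise, endpoint
approximations (a_δ, b_δ) of D and (c_δ, d_δ) of E, and a conformal g : D → E with boundary values a
↦ E.pt 0, b ↦ E.pt 1 and g(D') = E', there is ONE r ∈ [0, ∞] with P_δ^D(range γ ⊆ cl D') → r and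
P_δ^E(range γ ⊆ cl E') → r as δ → 0+ (full filter). With g = refl this is
approximation-independence; in general it is conformal invariance of the (value-free) avoidance
limits. Kennedy2002 tested the valued form Φ'_A(0)^(5/8) by Monte Carlo (arXiv:math/0112246 p.2).
[difficulty: open-problem] (why it might fail: Tensor RG yields scale+rotation covariance of
whole-plane impurity correlators at best; conformal invariance in Jordan domains needs a
boundary/OPE structure with no theorem even heuristically (card N3), and no critical fixed point is
certified yet even for Ising (arXiv:2506.03247 §4).) [LawlerSchrammWerner2004SAW,
LawlerSchrammWerner2003Restriction, Kennedy2002, Kennedy2004, KennedyLawler2013, KennedyRychkov2022,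
EbelKennedyRychkov2025Rotations, arXiv:2506.03247,
Literature.Barriers.CriticalPhenomena.ScaleCovarianceNotMoebius]
#3 IsotropicCorrelationLength (crux) — the engine's first milestone and the card's D4 ⇒ O(2) lemma
in theorem form (card S2/N0): for every ε > 0 there is x₀ < x_c such that for x₀ < x < x_c (x > 0)
some m = m(x) > 0 satisfies |log G_x(0, z) + m‖z‖₂| ≤ ε m ‖z‖₂ for all but finitely many z ∈ ℤ², G_x
= Σ_n c_n(0, z) xⁿ the subcritical two-point function (typed inline as Σ_n #{n-step SAWs of ℤ² from
0 to z}·xⁿ over zdGraph 2 path counts — term for term BDGS2012's SAW.Zd.twoPoint 2 1 x z by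
weaklyCountAt_one, checked `IsoOld ↔ IsoNew` rc 0 in the planner sketch — so that BDGS2012.lean and
its unproved riders stay out of the route's import cone): the inverse-correlation-length norm τ_x
(MadrasSlade1993 §1.3 (1.3.15), Thm 4.1.3, Cor. 4.1.15; Ornstein–Zernike §4.4) becomes Euclidean,
uniformly in direction, as x ↑ x_c — EKR's 'anisotropy ellipse is a circle' for the honest ℤ² SAW
tensor, where D4 makes an ellipse a circle but only an emergent O(2) makes the equi-decay curve an
ellipse. [difficulty: open-problem] (why it might fail: D4 only forces a D4-symmetric equi-decay
curve; that it is an ellipse (hence a circle) is emergent O(2) of the fixed point, and no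
rotation-preserving disentangling RG map exists to certify it (arXiv:2408.10312 §2.3 p.6);
off-critical control along the unstable manifold also needed.) [MadrasSlade1993,
EbelKennedyRychkov2025Rotations, Cardy1996, Beffara2008Universal, CampaninoIoffeVelenik2003,
Literature.Barriers.CriticalPhenomena.EmbeddingModulusUniqueness]
#4 SimpleSubseqLimits (crux) — (shared with SAWLoopFugacityFlow, stmt-CriticalPhenomena-4982, same
text) every subsequential weak limit ν of the pushed-forward critical SAW laws in (Ω_δ; a_δ, b_δ)
along s_n → 0+ is carried by SIMPLE curve classes from a to b with range in cl D meeting ∂D only at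
a, b — the carrier clause that AvoidanceDeterminesLaw and LSW03 need. [difficulty: open-problem]
(why it might fail: Weak limits of simple polylines need not be simple or boundary-avoiding: needs
no-macroscopic-self-approach and no-boundary-crawling bounds at x_c under every IsEndpointApprox;
only sub-ballisticity (DuminilCopinHammond2013) is in print.) [LawlerSchrammWerner2004SAW,
KennedyLawler2013, DuminilCopinHammond2013, arXiv:2310.17299, AizenmanBurchardDuke1999]
#5 RestrictionOfLimit (crux) — (shared with SAWConfRestriction, stmt-CriticalPhenomena-0773, same
text) every chordal family P that is the weak limit of the critical SAW laws for every domain and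
endpoint approximation satisfies two-sided restriction for all Jordan D' ⊆ D with the same marked
points: P D'(T) · P D(range ⊆ cl D') = P D(T ∩ (range ⊆ cl D')). Lattice level: an identity (LSW04
§3.4.5); content: portmanteau passage, null touching, largest-component bookkeeping. [difficulty: L]
(why it might fail: Typed for ALL Jordan D' ⊆ D sharing a, b (no agree-near-a,b proviso, as LSW03's
hypothesis demands): pinched D' make the event thin; touching of ∂D' by lattice walks and meshDomain
largest-component bookkeeping are beyond print.) [LawlerSchrammWerner2004SAW,
LawlerSchrammWerner2003Restriction, Lawler2005, KennedyLawler2013]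
#9 EventualTight (support) — (shared, stmt-CriticalPhenomena-1372, same text) eventual tightness:
for every Dobrushin domain and endpoint approximation there is δ₀ > 0 with the pushed-forward SAW
laws for δ ∈ (0, δ₀] a tight set on CurveClass ℂ (the repaired form of the refuted all-δ statement
stmt-0772). [difficulty: open-problem] [KemppainenSmirnov2017, AizenmanBurchardDuke1999,
DuminilCopinHammond2013]
#9 AvoidanceDeterminesLaw (support) — (shared, stmt-CriticalPhenomena-1373, same text) two
probability measures on CurveClass ℂ carried by simple boundary-avoiding chords of D from a to b
that give the same mass to every hull-subdomain avoidance event (D' ⊆ D agreeing with D near a, b)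
are equal (π-system of filled-hull complements; Lusin–Souslin for γ ↦ range). [difficulty: M]
[LawlerSchrammWerner2003Restriction, AizenmanBurchard1999]
#9 EndpointApproxExists (support) — every Dobrushin domain admits an endpoint approximation (a_δ,
b_δ) (sites of the largest component Ω_δ joined in Ω_δ with mesh points → a, b): the largest
component eventually swallows the lattice points of every compact connected K ⊂ Ω (area count), and
boundary points of a Jordan domain are accessible (AccessArc); diagonalise. Needed so that the limit
family is defined and conformally covariant on ALL Dobrushin domains. [difficulty: M]
[DuminilCopinSmirnov2012, Pommerenke1992, Smirnov2001]
#9 TurningInvariance (support) — the Hopf turning lemma that makes the n = 0 vertex-model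
contraction phase-free (card S1): for a Dobrushin (Jordan) domain, δ > 0, lattice stubs a' ∼ a, b ∼
b' with the mesh points of a', b' outside Ω, all SAWs of Ω_δ from a to b have the SAME total winding
of the stubbed polyline a', a, …, b, b' (Literature.Probability.LatticeModels.winding). Proof idea:
γ never crosses the stub edges nor ∂Ω, the stubs are attached to the connected set ℂ ∖ Ω, so two
such arcs differ by a null-homotopic rerouting in a simply connected region; a lattice Umlaufsatz
(cf. YangBaxterSAWBoundaryWinding.sum_ext_angles_eq_winding, ExplorationWinding) closes it. Reusable
by the parafermionic routes (boundary normalisation F(b)). [difficulty: M] [DuminilCopinSmirnov2012,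
Nienhuis1982, arXiv:cond-mat/0210548]
#9 LimitGlue (support) — the analytic glue (no new mathematics): Polish curve space + chordal
uniformizers + EndpointApproxExists + ConformalAvoidance + EventualTight + SimpleSubseqLimits +
AvoidanceDeterminesLaw ⟹ there is a chordal family P with (lim) for every Dobrushin domain and EVERY
endpoint approximation and (conf) conformal covariance — literally the text of
SAWConfRestriction.ConfCovLimit (stmt-0771). Proof: Prokhorov along any δ_n → 0+
(Literature.Probability.LatticeModels.exists_tendstoLaw_of_isTightMeasureSet with Q ν = 'simple
chordal carrier ∧ ν(range ⊆ cl D') = R⁺(D, D') for all hull subdomains', R⁺ the outer regularisation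
inf over D'' ⊃⊃ D' of the ConformalAvoidance limits, obtained by the closed/open portmanteau
sandwich and continuity from above); uniqueness in Q by AvoidanceDeterminesLaw;
approximation-independence from ConformalAvoidance with g = ConformalEquiv.refl; covariance: g_* P D
and P E are both in Q_E because hull subdomains and their avoidance limits correspond under g
(Carathéodory boundary extension for Jordan domains), then AvoidanceDeterminesLaw again.
[difficulty: L] [LawlerSchrammWerner2003Restriction, LawlerSchrammWerner2004SAW,
AizenmanBurchard1999, Pommerenke1992]
 #9 LSWCharacterisation (support) — the Lawler–Schramm–Werner chordal restriction characterisation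
BY NAME (:= Literature.Probability.RandomPlanarGeometry.LawlerSchrammWerner2003; arXiv:math/0209343
p. 5 result 2 with Prop. 3.3, Thm 6.1, Cor. 8.6, transposed to chordal families on Dobrushin
domains), PROVED in tree (LawlerSchrammWerner2003_holds, ConformalRestrictionHolds.lean); shared
with SAWConfRestriction.LSWCharacterisation (stmt-CriticalPhenomena-11214). Carried as an explicit
hypothesis of `closes` (cone repair 2026-08-15) instead of being inlined: the proof development
behind `_holds` is a 460-module import cone carrying 41 of the 43 unproved named facts the priority
module flagged (SLE(κ,ρ), SLE/Brownian bubbles, restriction-measure existence, SLE_8 trace, Itô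
formula; the other 2 are Percolation/CLE6 via SAWScalingLimitFamily) — none of them used by this
route (gate constant-cone check: 0 unproved / 96 constants). needs-fact: NONE. [difficulty:
provable-now; one line — but a Theorems file importing ConformalRestrictionHolds re-enters that cone
at link time: provers, prefer closing the sibling stmt-11214 the same way once the census counts
constant cones, or ask the operator]. [LawlerSchrammWerner2003Restriction, Lawler2005]

TWO-LAYER PLAN. Foreseen glued splits (nothing filed now): ConformalAvoidance ⇐ AvoidanceExists
(value-free full-filter existence + approximation-independence: the text of
SAWRestrictionRigidity.AvoidanceCocycleLimit strengthened by g = refl) → SimilarityToConformal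
(similarity-invariant avoidance limits with ALL rotations are conformally invariant — the residual
N3) → ConformalAvoidance, with the RG engine owning the first child and its rotation part;
IsotropicCorrelationLength ⇐ CriticalIsotropy (rotation-invariant scaling of critical-manifold
two-point data, EKR anisotropy ellipse = circle) → MassShellTransfer (isotropy propagates along the
unstable manifold to the correlation length) → IsotropicCorrelationLength; SimpleSubseqLimits ⇐
no-retracing ∧ boundary-avoidance as in SAWLoopFugacityFlow's plan (shared node, their split rides
here).

KILL CRITERIA. ¬ConformalAvoidance with EXISTING but conformally NON-invariant limits (an anisotropy
or a lattice-direction dependence surviving in an avoidance ratio) refutes the conjunct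
SAWScalingLimit itself, not just the route — close refuted:ConformalAvoidance and hand the witness
to the negatives index. ¬IsotropicCorrelationLength (a persistent anisotropy of the ℤ² SAW
correlation length at x_c, e.g. from long series) kills the D4 ⇒ O(2) mechanism and makes every
conformal-invariance route on ℤ² suspect: close refuted:IsotropicCorrelationLength.
¬SimpleSubseqLimits kills the LSW identification path (no pivot exists for an RG engine, which
cannot certify exponents exactly): close. The card's N0 experiment failing (no fixed tensor / Newton
diverges for the n = 0 complex tensor because of a D4-even eigenvalue-1 direction the rotation does
not flip) retires the ENGINE: route dormant, ConformalAvoidance stays wanted. ConfCovLimit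
(stmt-0771) proved elsewhere moots the RG engine but completes this Assembly too.

NOT DECOMPOSED YET. Everything inside the engine: the Banach-space setting of an untruncated
D4-covariant complex tensor RG map with quarter-turn (card N1), the impurity/defect sector and
boundary tensors for Jordan domains (N2/N3), the computer-assisted fixed-point enclosure — none is
typeable before a tensor-network / vertex-model contraction notion exists in Literature (definition
request below); the exact TN identity 'SAW two-point weight = e^(iθ) × 3-state vertex contraction'
(card S1) beyond its topological core TurningInvariance; constants (x_c enters only as 1/μ,
characterised dynamically as the crossing of the stable manifold, never numerically); the children
listed in the two-layer plan.

CHEAPEST FALSIFIER. Two cheap checks, neither run here (plancard seat, no kit in payload): (i) the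
card's N0 job — Gilt-TNR composed with the π/2 rotation and Newton (arXiv:2408.10312 §4.1 recipe) on
the bond-dimension-3 complex tensor T(x) at x = 0.379052277755 (= 1/μ, ClisbyJensen2012), χ ≤ 48:
convergence to a fixed tensor with leading D4-even eigenvalue ≈ 2^(2−2/3) = 2.52 (ν = 3/4) and an
anisotropy ellipse that is a circle; divergence or a surviving eigenvalue 1 kills the engine; (ii) a
series/Monte-Carlo lookup for IsotropicCorrelationLength: the ratio of diagonal to axial inverse
correlation lengths of the ℤ² SAW, τ_x(e^(iπ/4))/τ_x(1), must tend to 1 as x ↑ x_c with corrections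
O(ξ^(−2)) (spin-4 operator, dimension 4); exact-enumeration two-point data (JensenGuttmann1998-type
series) settle this to many digits.

NUMBERS. μ(ℤ²) = 2.63815853032790(3), x_c = 1/μ = 0.379052277755 (ClisbyJensen2012; only 2.62 < μ <
2.68 is rigorous, MadrasSlade1993 §1.2); predicted ν = 3/4, η = 5/24, boundary one-leg weight 5/8,
thermal dimension x_ε = 2/3, c = 0 (Nienhuis1982, LawlerSchrammWerner2004SAW,
Literature.Barriers.CriticalPhenomena.SAWNoUnitaryCFT); lattice-anisotropy operator: spin 4,
dimension 4 ⇒ isotropy corrections ∝ ξ^(−2) (Cardy1996 §3, 'Anisotropic scaling'); certified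
tensor-RG reach today: high-T basin of radius 0.02 (Hilbert–Schmidt, 63 sectors), Ising β ≤ 0.12, XY
β ≤ 0.18995 (arXiv:2506.03247 Thm 10, §3); EKR Newton accuracy 10^(−9) for the Ising critical tensor
(arXiv:2408.10312 §4.1). Items at open: 10 (4 cruxes). After the cone repair of 2026-08-15: 11 items
(4 cruxes, 6 support, 1 assembly); route imports ChordalCurveFamily, ConformalRestriction,
PolylineWinding (for `winding`, instead of FermionicObservable and its FK-Ising cone),
CaratheodoryHalfPlaneProofs (exists_isChordalUniformizing_holds; 20 proof modules, no unproved
fact); dropped: ConformalRestrictionHolds, SAWScalingLimitFamily, FermionicObservable, BDGS2012.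

DEFINITION REQUESTS. One, filed after open: notion `vertexModelPartitionFunction` (topic
Literature/Probability/LatticeModels) — the contraction Z = Σ_(σ : E → S) ∏_v w_v(σ|_(edges at v))
of a finite graph with finite edge-state type S and local complex vertex weights, with fixed
boundary leg states; motivating instance the 3-state n = 0 SAW tensor (weights 1 / x e^(±iπ/8) / x /
0). It makes card S1 (SAW weight = vertex contraction, via TurningInvariance) and later the engine
statements N1/N2 typeable. No cite facts requested: LSW03 is in tree and proved.

Novelty: Searches (2026-08-15): `lit search` ×3 ('tensor network renormalization self-avoiding walk O(n) loop
model corner transfer matrix', 'self-avoiding walk conformal invariance restriction Monte Carlo test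
SLE 8/3 Kennedy', 'self-avoiding walk correlation length anisotropy isotropy square lattice') —
searchd rc 75 (off-box service down all session, noted); `lit galaxy search --star all` 'tensor
network renormalization self-avoiding walk' (0), 'rigorous tensor network renormalization' (0),
`--star pdf` 'tensor renormalization group' (15, none on SAW/O(n → 0)), `--star pdf --title-contains
tensor` 'self-avoiding walk' (10, none relevant); `lit vsearch` 'anisotropy of the correlation
length of self-avoiding walks … rotational invariance near criticality' (10 books: MadrasSlade1993
pp.302/326, Cardy1996 pp.51–58 anisotropic scaling, Janse van Rensburg 2015); `lit read`
arXiv:2408.10312 pp.6–7,15–16 (no rotation-preserving disentangler; anisotropy ellipse; Newton to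
10^(−9)), arXiv:2506.03247 p.27 §4 (critical fixed point = stated long-range goal, June 2025),
arXiv:math/0112246 p.2 (MC test of Φ'_A(0)^(5/8)), book:madras1993 pp.15, 84, 108 (mass, Cor.
4.1.15, OZ §4.4); the card's audited prior-art list (refuter-novelty-audit …-11-0:
arXiv:cond-mat/0210548 Foster–Pinettes CTMRG of the SAW vertex model; KennedyRychkov2022;
EbelKennedyRychkov2025Rotations).
Nearest prior art found: EbelKennedyRychkov2025 (arXiv:2506.03247: computer-assisted tensor RG,
high-T basin only) with EbelKennedyR  [refs: 2408.10312, 2506.03247, math/0112246, cond-mat/0210548, book:madras1993, MadrasSlade1993, Cardy1996, KennedyRychkov2022, EbelKennedyRychkov2025, Kennedy2002]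

Barriers (technique_class: tensor-network-rg computer-assisted conformal-restriction): - technique_class: tensor-network-rg computer-assisted conformal-restriction
- Literature.Barriers.CriticalPhenomena.RigorousRGSmallParameter: it does not evade it in print; the
bet is the card's — interval arithmetic around a numerically located non-trivial fixed tensor
replaces the small parameter ε (realised so far only for the trivial high-T fixed point,
arXiv:2506.03247 Thm 10); the barrier's scope caveat (a) 'no theorem says an RG construction cannot
work at strong coupling' is exactly the opening.
- Literature.Barriers.CriticalPhenomena.RigorousRGSmallParameterNarrow: evaded by construction class
— the narrowed audit itself records 'computer-assisted RG constructions without a small parameter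
(KochWittwer1994, HaraHattoriWatanabe2001) are NOT in the class, so far hierarchical only'; this
line is exactly that excluded family taken to the FULL lattice: the distance of the n = 0 fixed
tensor from the trivial (high-T / empty, Z = 1) tensor is not small and is never used as an
expansion parameter — interval enclosures around the numerically located fixed tensor replace it
(the full-lattice precedent is the certified high-T basin, arXiv:2506.03247 Thm 10); the honest
caveat is the audit's: no full-lattice non-trivial fixed point has been certified yet.
- Literature.Barriers.CriticalPhenomena.PositionSpaceRGNonGibbsian: evaded — tensor RG renormalises
a tensor in Hilbert–Schmidt norm (transfer-operator data), never a Hamiltonian or a Gibbs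
specification, so van Enter–Fernánde

History (route lifecycle, newest last):
- 2026-08-15T16:54:57Z · rev 1: restated Assembly (stmt-CriticalPhenomena-7609) — route-repair (rbadge g2, glue stamp D-0027 §2.1): deciding theorem closes : ConformalAvoidance → IsotropicCorrelationLength → SimpleSubseqLimits → RestrictionOf (planner-rbadge-CriticalPhenomena-SAWTensorRG-81e282d4-g2-0)
- 2026-08-15T17:16:42Z · rev 2: restated IsotropicCorrelationLength (stmt-CriticalPhenomena-7606) — cone repair 1/2: restate IsotropicCorrelationLength with its two-point series typed inline over zdGraph 2 path counts (term for term SAW.Zd.twoPoint 2 1 x z by (planner-rrepair-CriticalPhenomena-SAWTensorRG-81e282d4-0)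
- 2026-08-15T17:28:39Z · rev 4: restated Assembly (stmt-CriticalPhenomena-11217) — cone repair 2/2 (route-repair, priority guardrail: 43 unproved named facts in the route file's IMPORT closure, 0 in the gate's constant cone): re-route around t (planner-rrepair-CriticalPhenomena-SAWTensorRG-81e282d4-0)

sub-problem: SAWScalingLimit · status: open · opened planner-plancard-CriticalPhenomena-SAWScaling-d1e2abde-0 2026-08-15T12:12:52Z · rev 4 · ledger route-CriticalPhenomena-SAWTensorRG
GENERATED by the gate from the ledger (D-0016/17). Provers cite these decls: `theorem foo : Summit.CriticalPhenomena.SAWScalingLimit.Theses.SAWTensorRG.<Decl> := …` in Summits/CriticalPhenomena/SAWScalingLimit/Theorems/<Name>.lean.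
-/

namespace Summit.CriticalPhenomena.SAWScalingLimit.Theses.SAWTensorRG

open scoped BigOperators Topology Manifold Classical MeasureTheory ProbabilityTheory Matrix InnerProductSpace ComplexConjugate ContinuousMap
open Filter Set Function TopologicalSpace MeasureTheory

attribute [summit_statement] _root_.SAWScalingLimit

/-- item stmt-CriticalPhenomena-7605 · crux · rank 2 · open · by planner
why it might fail: Tensor RG yields scale+rotation covariance of whole-plane impurity correlators at best; conformal invariance in Jordan domains needs a boundary/OPE structure with no theorem even heuristically (card N3), and no critical fixed point is certified yet even for Ising (arXiv:2506.03247 §4).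
sources: LawlerSchrammWerner2004SAW, LawlerSchrammWerner2003Restriction, Kennedy2002, Kennedy2004, KennedyLawler2013, KennedyRychkov2022
[crux] card N1+N2+N3 in typed lattice form — for Dobrushin D ⊇ D' (same marked points, agreeing in
balls around a and b), E ⊇ E' likewise, endpoint approximations (a_δ, b_δ) of D and (c_δ, d_δ) of E,
and a conformal g : D → E with boundary values a ↦ E.pt 0, b ↦ E.pt 1 and g(D') = E', there is ONE r
∈ [0, ∞] with P_δ^D(range γ ⊆ cl D') → r and P_δ^E(range γ ⊆ cl E') → r as δ → 0+ (full filter).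
With g = refl this is approximation-independence; in general it is conformal invariance of the
(value-free) avoidance limits. Kennedy2002 tested the valued form Φ'_A(0)^(5/8) by Monte Carlo
(arXiv:math/0112246 p.2). [difficulty: open-problem] -/
@[route_item "route-CriticalPhenomena-SAWTensorRG", crux]
def ConformalAvoidance : Prop :=
  ∀ (D D' E E' : Literature.Probability.RandomPlanarGeometry.DobrushinDomain) (a b c d : ℝ → Literature.Probability.LatticeModels.Site 2) (g : Literature.Probability.RandomPlanarGeometry.ConformalEquiv D.carrier E.carrier), Literature.Probability.RandomPlanarGeometry.SAW.IsEndpointApprox D a b → Literature.Probability.RandomPlanarGeometry.SAW.IsEndpointApprox E c d → D'.carrier ⊆ D.carrier → D'.pt 0 = D.pt 0 → D'.pt 1 = D.pt 1 → (∃ ε : ℝ, 0 < ε ∧ D'.carrier ∩ Metric.ball (D.pt 0) ε = D.carrier ∩ Metric.ball (D.pt 0) ε ∧ D'.carrier ∩ Metric.ball (D.pt 1) ε = D.carrier ∩ Metric.ball (D.pt 1) ε) → E'.carrier ⊆ E.carrier → E'.pt 0 = E.pt 0 → E'.pt 1 = E.pt 1 → (∃ ε : ℝ, 0 < ε ∧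 E'.carrier ∩ Metric.ball (E.pt 0) ε = E.carrier ∩ Metric.ball (E.pt 0) ε ∧ E'.carrier ∩ Metric.ball (E.pt 1) ε = E.carrier ∩ Metric.ball (E.pt 1) ε) → g.HasBoundaryValue (D.pt 0) (E.pt 0) → g.HasBoundaryValue (D.pt 1) (E.pt 1) → g '' D'.carrier = E'.carrier → ∃ r : ENNReal, Filter.Tendsto (fun δ => ((Literature.Probability.RandomPlanarGeometry.SAW.law D.carrier δ (a δ) (b δ)).map (fun γ => γ.curve)) (Literature.Probability.RandomPlanarGeometry.CurveClass.rangeSubset (closure D'.carrier))) (nhdsWithin 0 (Set.Ioi 0)) (nhds r) ∧ Filter.Tendsto (fun δ => ((Literature.Probability.RandomPlanarGeometry.SAW.law E.carrier δ (c δ) (d δ)).map (fun γ => γ.curve)) (Literature.Probability.RandomPlanarGeometry.CurveClass.rangeSubset (closure E'.carrier))) (nhdsWithin 0 (Set.Ioi 0)) (nhds r)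

-- earlier IsotropicCorrelationLength (stmt-CriticalPhenomena-7606, replaced 2026-08-15T17:16:42Z -> stmt-CriticalPhenomena-11347): retired by None — ∀ ε : ℝ, 0 < ε → ∃ x₀ : ℝ, x₀ < Literature.Probability.RandomPlanarGeometry.SAW.criticalFugacity ∧ ∀ x : ℝ, 0 < x → x₀ < x → x < Literature.Probability.RandomPlanarGeometry.SAW.criticalFugacity → ∃ m : ℝ, 0 < m ∧ ∀ᶠ z : Literature.Probability.LatticeMod
/-- item stmt-CriticalPhenomena-11347 · crux · rank 3 · open · by planner
why it might fail: D4 only forces a D4-symmetric equi-decay curve; that it is an ellipse (hence a circle) is emergent O(2) of the fixed point, and no rotation-preserving disentangling RG map exists to certify it (arXiv:2408.10312 §2.3 p.6); off-critical control along the unstable manifold also needed.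
sources: MadrasSlade1993, EbelKennedyRychkov2025Rotations, Cardy1996, Beffara2008Universal, CampaninoIoffeVelenik2003, Literature.Barriers.CriticalPhenomena.EmbeddingModulusUniqueness
[crux] the engine's first milestone and the card's D4 ⇒ O(2) lemma in theorem form (card S2/N0): for
every ε > 0 there is x₀ < x_c such that for x₀ < x < x_c (x > 0) some m = m(x) > 0 satisfies |log
G_x(0, z) + m‖z‖₂| ≤ ε m ‖z‖₂ for all but finitely many z ∈ ℤ², G_x(0, z) = Σ_n c_n(0, z) xⁿ the
subcritical two-point function — typed INLINE as the series over n of (number of n-step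
self-avoiding walks of ℤ² from 0 to z, i.e. paths among (zdGraph 2).finsetWalkLength n 0 z) · xⁿ,
which is term for term BDGS2012's Literature.Probability.RandomPlanarGeometry.SAW.Zd.twoPoint 2 1 x
z (weaklyCountAt_one; `IsoOld ↔ IsoNew` checked rc 0 in the planner sketch, cone repair 2026-08-15:
BDGS2012.lean is no longer imported by the route file; provers may import it and rewrite with
weaklyCountAt_one): the inverse-correlation-length norm τ_x (MadrasSlade1993 §1.3 (1.3.15), Thm
4.1.3, Cor. 4.1.15; Ornstein–Zernike §4.4) becomes Euclidean, uniformly in direction, as x ↑ x_c —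
EKR's 'anisotropy ellipse is a circle' for the honest ℤ² SAW tensor, where D4 makes an ellipse a
circle but only an emergent O(2) makes the equi-decay curve an ellipse. [difficulty: open-problem] -/
@[route_item "route-CriticalPhenomena-SAWTensorRG", crux]
def IsotropicCorrelationLength : Prop :=
  ∀ ε : ℝ, 0 < ε → ∃ x₀ : ℝ, x₀ < Literature.Probability.RandomPlanarGeometry.SAW.criticalFugacity ∧ ∀ x : ℝ, 0 < x → x₀ < x → x < Literature.Probability.RandomPlanarGeometry.SAW.criticalFugacity → ∃ m : ℝ, 0 < m ∧ ∀ᶠ z : Literature.Probability.LatticeModels.Site 2 in Filter.cofinite, |Real.log (∑' n : ℕ, ((((Literature.Probability.LatticeModels.zdGraph 2).finsetWalkLength n (0 : Literature.Probability.LatticeModels.Site 2) z).filter fun p => p.IsPath).card : ℝ) * x ^ n) + m * ‖Literature.Probability.LatticeModels.Site.toComplex z‖| ≤ ε * m * ‖Literature.Probability.LatticeModels.Site.toComplex z‖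

/-- item stmt-CriticalPhenomena-4982 · crux · rank 4 · open · by planner
why it might fail: Weak limits of simple polylines need not be simple or boundary-avoiding: needs no-macroscopic-self-approach and no-boundary-crawling bounds at x_c under every IsEndpointApprox; only sub-ballisticity (DuminilCopinHammond2013) is in print.
sources: LawlerSchrammWerner2004SAW, KennedyLawler2013, DuminilCopinHammond2013, arXiv:2310.17299, AizenmanBurchardDuke1999
[crux] (S): for every Dobrushin domain, endpoint approximation, sequence s_n → 0+ and probability
measure ν on CurveClass ℂ that is the weak limit of the pushed-forward SAW laws along s_n, ν-a.e.
curve class is simple, runs from a = D.pt 0 to b = D.pt 1, has range in closure D and meets ∂D only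
at a, b (exactly the carrier clause of AvoidanceDeterminesLaw). Subsequential form of
SAWConfRestriction.SimpleOfLimit (stmt-CriticalPhenomena-0774). Foreseen split: 'range is a simple
boundary-avoiding arc' (follows from AvoidanceLimit + LSW Lemma 3.2 on filled ranges + SLE_(8/3)
simplicity) ∧ 'no retracing' (a near-self-approach estimate for x_c-SAW). [difficulty: open-problem] -/
@[route_item "route-CriticalPhenomena-SAWTensorRG", crux]
def SimpleSubseqLimits : Prop :=
  ∀ (D : Literature.Probability.RandomPlanarGeometry.DobrushinDomain) (a b : ℝ → Literature.Probability.LatticeModels.Site 2), Literature.Probability.RandomPlanarGeometry.SAW.IsEndpointApprox D a b → ∀ (s : ℕ → ℝ) (ν : MeasureTheory.Measure (Literature.Probability.RandomPlanarGeometry.CurveClass ℂ)), Filter.Tendsto s Filter.atTop (nhdsWithin 0 (Set.Ioi 0)) → MeasureTheory.IsProbabilityMeasure ν → (∀ f : BoundedContinuousFunction (Literature.Probability.RandomPlanarGeometry.CurveClass ℂ) ℝ, Filter.Tendsto (fun n => ∫ γ, f γ.curve ∂(Literature.Probability.RandomPlanarGeometry.SAW.law D.carrier (s n) (a (s n)) (b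 (s n)))) Filter.atTop (nhds (∫ x, f x ∂ν))) → ∀ᵐ γ ∂ν, γ ∈ Literature.Probability.RandomPlanarGeometry.CurveClass.simple ∧ γ.source = D.pt 0 ∧ γ.target = D.pt 1 ∧ γ.range ⊆ closure D.carrier ∧ γ.range ∩ frontier D.carrier ⊆ {D.pt 0, D.pt 1}

/-- item stmt-CriticalPhenomena-0773 · crux · rank 5 · open · by planner
why it might fail: Typed for ALL Jordan D' ⊆ D sharing a, b (no agree-near-a,b proviso, as LSW03's hypothesis demands): pinched D' make the event thin; touching of ∂D' by lattice walks and meshDomain largest-component bookkeeping are beyond print.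
sources: LawlerSchrammWerner2004SAW, LawlerSchrammWerner2003Restriction, Lawler2005, KennedyLawler2013
[crux] r4: every chordal family P that is the weak limit (lim) of the critical SAW laws satisfies
the restriction property: for Jordan D' ⊆ D with the same marked points and measurable T, P D'(T) ·
P D(range ⊆ closure D') = P D(T ∩ {range ⊆ closure D'}). At lattice level this is an identity (LSW04
arXiv:math/0204277 p.24); the content is the passage to the limit (portmanteau on a closed event,
boundary-touching has P D-measure 0). -/
@[route_item "route-CriticalPhenomena-SAWTensorRG", crux]
def RestrictionOfLimit : Prop :=
  ∀ P : Literature.Probability.RandomPlanarGeometry.ChordalFamily, P.IsChordal → (∀ (D : Literature.Probability.RandomPlanarGeometry.DobrushinDomain) (a b : ℝ → Literature.Probability.LatticeModels.Site 2), Literature.Probability.RandomPlanarGeometry.SAW.IsEndpointApprox D a b → Literature.Probability.RandomPlanarGeometry.TendstoLaw (fun δ (γ : Literature.Probability.RandomPlanarGeometry.SAW.DomainSAW D.carrier δ (a δ) (b δ)) => γ.curve) (fun δ => Literature.Probability.RandomPlanarGeometry.SAW.law D.carrier δ (a δ) (b δ)) id (P D)) → ∀ (D D' : Literature.Probability.RandomPlanarGeometry.DobrushinDomain),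 D'.carrier ⊆ D.carrier → D'.pt 0 = D.pt 0 → D'.pt 1 = D.pt 1 → ∀ T : Set (Literature.Probability.RandomPlanarGeometry.CurveClass ℂ), MeasurableSet T → P D' T * P D (Literature.Probability.RandomPlanarGeometry.CurveClass.rangeSubset (closure D'.carrier)) = P D (T ∩ Literature.Probability.RandomPlanarGeometry.CurveClass.rangeSubset (closure D'.carrier))

/-- item stmt-CriticalPhenomena-11214 · support · rank 9 · open · by planner
sources: LawlerSchrammWerner2003Restriction, Lawler2005
[support] The Lawler–Schramm–Werner chordal conformal-restriction characterisation BY NAME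
(Literature def `LawlerSchrammWerner2003`, ConformalRestriction.lean; arXiv:math/0209343 p.5 result
2 with Prop. 3.3, Thm 6.1, Cor. 8.6, transposed to chordal families on Dobrushin domains): a
chordal, conformally covariant family with two-sided restriction carried by simple curves meeting
the boundary only at the marked points is, in every domain, the chordal SLE_{8/3} law. PROVED in
tree (`Literature.Probability.RandomPlanarGeometry.LawlerSchrammWerner2003_holds`,
ConformalRestrictionHolds.lean, whitelisted axioms); one-line closure `theorem … :
LSWCharacterisation := Literature.Probability.RandomPlanarGeometry.LawlerSchrammWerner2003_holds`.
Carried as an explicit item (4th hypothesis of `closes`) instead of being inlined so that the route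
module imports the 13-module statement file and not the 460-module proof file, whose import cone
carries the remaining ≤ 36 of the 38 flagged unproved named facts (SLE(κ,ρ), Brownian/SLE bubbles,
restriction-measure existence, SLE_8 trace, Itô formula) — none used by this route — cone repair
2026-08-15. Supersedes the dropped LSWRestrictionFact (stmt-Cri -/
@[route_item "route-CriticalPhenomena-SAWTensorRG", crux]
def LSWCharacterisation : Prop :=
  Literature.Probability.RandomPlanarGeometry.LawlerSchrammWerner2003

/-- item stmt-CriticalPhenomena-1372 · support · rank 9 · open · by planner
sources: KemppainenSmirnov2017, AizenmanBurchardDuke1999, DuminilCopinHammond2013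
[support] eventual tightness of the pushed-forward critical SAW laws: for every Dobrushin domain and
endpoint approximation there is δ₀ > 0 such that {(law D δ a_δ b_δ).map curve : δ ∈ (0, δ₀]} is a
tight set of measures on CurveClass ℂ — the repaired (∃ δ₀) form of the refuted all-δ statement
stmt-CriticalPhenomena-0772 suggested by its refutation; child-designate of LimitExists, shared need
of every SAW route. Intended tools: Aizenman–Burchard / Kemppainen–Smirnov Condition G2 (an
annulus-crossing bound at x_c not in print). Sources: KemppainenSmirnov2017 Thm 1.5,
AizenmanBurchardDuke1999, DuminilCopinHammond2013. -/
@[route_item "route-CriticalPhenomena-SAWTensorRG", crux]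
def EventualTight : Prop :=
  ∀ (D : Literature.Probability.RandomPlanarGeometry.DobrushinDomain) (a b : ℝ → Literature.Probability.LatticeModels.Site 2), Literature.Probability.RandomPlanarGeometry.SAW.IsEndpointApprox D a b → ∃ δ₀ : ℝ, 0 < δ₀ ∧ MeasureTheory.IsTightMeasureSet ((fun δ => (Literature.Probability.RandomPlanarGeometry.SAW.law D.carrier δ (a δ) (b δ)).map (fun γ => γ.curve)) '' Set.Ioc 0 δ₀)

/-- item stmt-CriticalPhenomena-1373 · support · rank 9 · closed · proved by Summit.CriticalPhenomena.SAWScalingLimit.Theorems.AvoidanceDeterminesLaw.AvoidanceDeterminesLaw_proof (prover) · by planner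
sources: LawlerSchrammWerner2003Restriction, AizenmanBurchard1999
[support] avoidance determines the law: two probability measures on CurveClass ℂ carried by SIMPLE
chords of the Dobrushin domain D from a to b meeting ∂D only at a, b, which give the same mass to
{range ⊆ closure D'} for every Dobrushin D' ⊆ D with the same marked points and agreeing with D near
a and b (the form delivered by AvoidanceCocycleLimit), are equal (π-system of filled hull
complements generating the Borel sets of simple boundary-avoiding chords: a simple chord is
determined by its range; Lusin–Souslin for γ ↦ range). Planar-topology/measure-theory analogue of
LSW03 §3 ('the law of K is determined by P[K ∩ A = ∅]'); used for uniqueness of subsequential SAW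
limits and for uniqueness of the restriction extension to slit domains. Sources:
LawlerSchrammWerner2003Restriction §3, AizenmanBurchard1999 §2.1. -/
@[route_item "route-CriticalPhenomena-SAWTensorRG", crux]
def AvoidanceDeterminesLaw : Prop :=
  ∀ (D : Literature.Probability.RandomPlanarGeometry.DobrushinDomain) (μ ν : MeasureTheory.Measure (Literature.Probability.RandomPlanarGeometry.CurveClass ℂ)), MeasureTheory.IsProbabilityMeasure μ → MeasureTheory.IsProbabilityMeasure ν → (∀ᵐ γ ∂μ, γ ∈ Literature.Probability.RandomPlanarGeometry.CurveClass.simple ∧ γ.source = D.pt 0 ∧ γ.target = D.pt 1 ∧ γ.range ⊆ closure D.carrier ∧ γ.range ∩ frontier D.carrier ⊆ {D.pt 0, D.pt 1}) → (∀ᵐ γ ∂ν, γ ∈ Literature.Probability.RandomPlanarGeometry.CurveClass.simple ∧ γ.source = D.pt 0 ∧ γ.target = D.pt 1 ∧ γ.range ⊆ closure D.carrier ∧ γ.range ∩ frontier D.carrier ⊆ {D.pt 0, D.pt 1}) → (∀ D' : Literature.Probability.RandomPlanarGeometry.DobrushinDomain, D'.carrier ⊆ D.carrier → D'.pt 0 =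 D.pt 0 → D'.pt 1 = D.pt 1 → (∃ ε : ℝ, 0 < ε ∧ D'.carrier ∩ Metric.ball (D.pt 0) ε = D.carrier ∩ Metric.ball (D.pt 0) ε ∧ D'.carrier ∩ Metric.ball (D.pt 1) ε = D.carrier ∩ Metric.ball (D.pt 1) ε) → μ (Literature.Probability.RandomPlanarGeometry.CurveClass.rangeSubset (closure D'.carrier)) = ν (Literature.Probability.RandomPlanarGeometry.CurveClass.rangeSubset (closure D'.carrier))) → μ = ν

/-- `AvoidanceDeterminesLaw` holds: proved by `Summit.CriticalPhenomena.SAWScalingLimit.Theorems.AvoidanceDeterminesLaw.AvoidanceDeterminesLaw_proof`. -/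
theorem AvoidanceDeterminesLaw_holds : AvoidanceDeterminesLaw := _root_.Summit.CriticalPhenomena.SAWScalingLimit.Theorems.AvoidanceDeterminesLaw.AvoidanceDeterminesLaw_proof

/-- item stmt-CriticalPhenomena-4866 · support · rank 9 · open · by planner
sources: DuminilCopinSmirnov2012, Pommerenke1992, Smirnov2001
[support] every Dobrushin domain admits at least one endpoint approximation (SAW.IsEndpointApprox D
a b: lattice endpoints joined in Ω_δ for all small δ whose mesh points tend to the marked prime ends
a, b). Needed to instantiate SubseqSimple / SimpleOfLimit-type statements at EVERY domain in the
Assembly (LSWRestrictionFact wants (simple) for all D). Expected provable now: accessibility of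
boundary points of a Jordan domain + the largest component of δℤ² ∩ Ω eventually contains every
compactly supported grid patch (cf. the unit-disc instance proved in
Literature/Barriers/CriticalPhenomena/SupercriticalSAWSpaceFillingProblem10.lean:166); the only
delicate point is meshDomain's largest-component convention for wild Jordan boundaries. [difficulty:
M] -/
@[route_item "route-CriticalPhenomena-SAWTensorRG", crux]
def EndpointApproxExists : Prop :=
  ∀ D : Literature.Probability.RandomPlanarGeometry.DobrushinDomain, ∃ a b : ℝ → Literature.Probability.LatticeModels.Site 2, Literature.Probability.RandomPlanarGeometry.SAW.IsEndpointApprox D a b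

/-- item stmt-CriticalPhenomena-7607 · support · rank 9 · open · by planner
sources: DuminilCopinSmirnov2012, Nienhuis1982, arXiv:cond-mat/0210548
[support] the Hopf turning lemma that makes the n = 0 vertex-model contraction phase-free (card S1):
for a Dobrushin (Jordan) domain, δ > 0, lattice stubs a' ∼ a, b ∼ b' with the mesh points of a', b'
outside Ω, all SAWs of Ω_δ from a to b have the SAME total winding of the stubbed polyline a', a, …,
b, b' (Literature.Probability.LatticeModels.winding). Proof idea: γ never crosses the stub edges nor
∂Ω, the stubs are attached to the connected set ℂ ∖ Ω, so two such arcs differ by a null-homotopic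
rerouting in a simply connected region; a lattice Umlaufsatz (cf.
YangBaxterSAWBoundaryWinding.sum_ext_angles_eq_winding, ExplorationWinding) closes it. Reusable by
the parafermionic routes (boundary normalisation F(b)). [difficulty: M] -/
@[route_item "route-CriticalPhenomena-SAWTensorRG", crux]
def TurningInvariance : Prop :=
  ∀ (D : Literature.Probability.RandomPlanarGeometry.DobrushinDomain) (δ : ℝ) (a b a' b' : Literature.Probability.LatticeModels.Site 2) (γ₁ γ₂ : Literature.Probability.RandomPlanarGeometry.SAW.DomainSAW D.carrier δ a b), 0 < δ → (Literature.Probability.LatticeModels.zdGraph 2).Adj a' a → (Literature.Probability.LatticeModels.zdGraph 2).Adj b b' → Literature.Probability.LatticeModels.meshPoint δ a' ∉ D.carrier → Literature.Probability.LatticeModels.meshPoint δ b' ∉ D.carrier → Literature.Probability.LatticeModels.winding (Literature.Probability.LatticeModels.meshPoint δ a' :: (γ₁.walk.support.map (Literature.Probability.LatticeModels.meshPoint δ)) ++ [Literature.Probability.LatticeModels.meshPoint δ b']) = Literature.Probability.LatticeModels.winding (Literature.Probability.LatticeModels.meshPoint δ a' :: (γ₂.walk.support.map (Literature.Probability.LatticeModels.meshPoint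 δ)) ++ [Literature.Probability.LatticeModels.meshPoint δ b'])

/-- item stmt-CriticalPhenomena-7608 · support · rank 9 · open · by planner
sources: LawlerSchrammWerner2003Restriction, LawlerSchrammWerner2004SAW, AizenmanBurchard1999, Pommerenke1992
[support] the analytic glue (no new mathematics): Polish curve space + chordal uniformizers +
EndpointApproxExists + ConformalAvoidance + EventualTight + SimpleSubseqLimits +
AvoidanceDeterminesLaw ⟹ there is a chordal family P with (lim) for every Dobrushin domain and EVERY
endpoint approximation and (conf) conformal covariance — literally the text of
SAWConfRestriction.ConfCovLimit (stmt-0771). Proof: Prokhorov along any δ_n → 0+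
(Literature.Probability.LatticeModels.exists_tendstoLaw_of_isTightMeasureSet with Q ν = 'simple
chordal carrier ∧ ν(range ⊆ cl D') = R⁺(D, D') for all hull subdomains', R⁺ the outer regularisation
inf over D'' ⊃⊃ D' of the ConformalAvoidance limits, obtained by the closed/open portmanteau
sandwich and continuity from above); uniqueness in Q by AvoidanceDeterminesLaw;
approximation-independence from ConformalAvoidance with g = ConformalEquiv.refl; covariance: g_* P D
and P E are both in Q_E because hull subdomains and their avoidance limits correspond under g
(Carathéodory boundary extension for Jordan domains), then AvoidanceDeterminesLaw again.
[difficulty: L] -/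
@[route_item "route-CriticalPhenomena-SAWTensorRG", crux]
def LimitGlue : Prop :=
  Literature.Probability.RandomPlanarGeometry.CurveClass.polishSpace (E := ℂ) → Literature.Probability.RandomPlanarGeometry.MarkedDomain.exists_isChordalUniformizing → EndpointApproxExists → ConformalAvoidance → EventualTight → SimpleSubseqLimits → AvoidanceDeterminesLaw → ∃ P : Literature.Probability.RandomPlanarGeometry.ChordalFamily, P.IsChordal ∧ (∀ (D : Literature.Probability.RandomPlanarGeometry.DobrushinDomain) (a b : ℝ → Literature.Probability.LatticeModels.Site 2), Literature.Probability.RandomPlanarGeometry.SAW.IsEndpointApprox D a b → Literature.Probability.RandomPlanarGeometry.TendstoLaw (fun δ (γ : Literature.Probability.RandomPlanarGeometry.SAW.DomainSAW D.carrier δ (a δ) (b δ)) => γ.curve) (fun δ => Literature.Probability.RandomPlanarGeometry.SAW.law D.carrier δ (a δ) (b δ)) id (P D)) ∧ (∀ (D D' : Literature.Probability.RandomPlanarGeometry.DobrushinDomain) (g : Literature.Probability.RandomPlanarGeometry.ConformalEquiv D.carrier D'.carrier) (Φ : C(ℂ, ℂ)), g.HasBoundaryValue (D.pt 0) (D'.pt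 0) → g.HasBoundaryValue (D.pt 1) (D'.pt 1) → Set.EqOn Φ g D.carrier → P D' = (P D).map (Literature.Probability.RandomPlanarGeometry.CurveClass.map Φ))

-- earlier Assembly (stmt-CriticalPhenomena-11217, replaced 2026-08-15T17:28:39Z -> stmt-CriticalPhenomena-11386): retired by None — Summit.CriticalPhenomena.SAWScalingLimit.Theses.SAWTensorRG.EndpointApproxExists → Summit.CriticalPhenomena.SAWScalingLimit.Theses.SAWTensorRG.ConformalAvoidance → Summit.CriticalPhenomena.SAWScalingLimit.Theses.SAWTensorRG.EventualTight → Summit.CriticalPhenomena.SAWSc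
-- earlier Assembly (stmt-CriticalPhenomena-7609, replaced 2026-08-15T16:54:57Z -> stmt-CriticalPhenomena-11217): retired by None — Literature.Probability.RandomPlanarGeometry.exists_isSLECurve → Literature.Probability.RandomPlanarGeometry.IsSLECurve.map_eq → Literature.Probability.RandomPlanarGeometry.LawlerSchrammWerner2003 → Literature.Probability.RandomPlanarGeometry.CurveClass.polishSpace (E := 
/-- item stmt-CriticalPhenomena-11386 · assembly · rank 1 · open · by planner
sources: LawlerSchrammWerner2003Restriction, LawlerSchrammWerner2004SAW
[assembly] LawlerSchrammWerner2003 → EndpointApproxExists → ConformalAvoidance → EventualTight →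
SimpleSubseqLimits → AvoidanceDeterminesLaw → RestrictionOfLimit → LimitGlue → SAWScalingLimit (cone
repair 2026-08-15: the LSW characterisation enters as the first antecedent — the Literature fact by
name, = item LSWCharacterisation — so the assembly is provable with the route file's own light
imports; it is the deciding theorem `closes` of this file minus its three passenger hypotheses).
Proof (candidate rc 0, 0 sorries in the planner's Sketch.lean with exactly the route's imports): P
from LimitGlue fed CurveClass.polishSpace_holds and MarkedDomain.exists_isChordalUniformizing_holds
(both PROVED, light); (restr) from RestrictionOfLimit; (simple) from SimpleSubseqLimits along δ_n =
1/(n+1) with endpoints from EndpointApproxExists; IsSLELaw (8/3) D (P D) from the antecedent; then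
integral_map (SAW.aemeasurable_curve) turns (lim) into ConvergesInLawToSLE (8/3) D. Provers: do NOT
import ConformalRestrictionHolds / SAWScalingLimitFamily / BDGS2012 for it (import-cone hygiene) —
the route file's imports suffice. [difficulty: provable-now] -/
@[route_item "route-CriticalPhenomena-SAWTensorRG", crux]
def Assembly : Prop :=
  Literature.Probability.RandomPlanarGeometry.LawlerSchrammWerner2003 → EndpointApproxExists → ConformalAvoidance → EventualTight → SimpleSubseqLimits → AvoidanceDeterminesLaw → RestrictionOfLimit → LimitGlue → SAWScalingLimit

/-! D-0027 §2.1 — DECIDING THEOREM (planner-authored via `route open/edit --closes-file`; by planner-rrepair-CriticalPhenomena-SAWTensorRG-81e282d4-0 2026-08-15T17:28:39Z):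
its hypotheses are this route's items and its conclusion the sub-problem Statement (glue_lint), and it elaborates with this file. -/

-- D-0027 §2.1 deciding theorem of route SAWTensorRG (cone repair 2026-08-15).
-- The RG engine's output `ConformalAvoidance`, with `EventualTight`, `SimpleSubseqLimits`,
-- `AvoidanceDeterminesLaw`, `EndpointApproxExists` and the analytic glue `LimitGlue` (whose two
-- Literature antecedents are PROVED in tree: `CurveClass.polishSpace_holds` (CurveSpace.lean) and
-- `MarkedDomain.exists_isChordalUniformizing_holds` (CaratheodoryHalfPlaneProofs.lean, a clean
-- 20-module complex-analysis cone), yields a chordal, conformally covariant family `P` that is the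
-- weak limit of the critical SAW laws for every endpoint approximation; `RestrictionOfLimit` gives
-- hull restriction; `SimpleSubseqLimits` along `δ_n = 1/(n+1)` (endpoints from `EndpointApproxExists`)
-- gives the simple boundary-avoiding carrier of every `P D`; the Lawler–Schramm–Werner chordal
-- restriction characterisation, carried BY NAME as the support item `LSWCharacterisation`
-- (`:= Literature.Probability.RandomPlanarGeometry.LawlerSchrammWerner2003`, PROVED in tree as
-- `LawlerSchrammWerner2003_holds`; kept as an item so that this module imports the light statement
-- file `ConformalRestriction.lean`, not the 460-module proof development), identifies every `P D` as
-- chordal SLE_{8/3}; finally the test integrals of (lim) are moved along `integral_map` (the two-line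
-- argument of `SAW.IsScalingLimitFamily.sawScalingLimit`, inlined so that `SAWScalingLimitFamily` —
-- and through it `Percolation/CLE6` — is not imported). `IsotropicCorrelationLength`,
-- `TurningInvariance` (engine milestones) and `Assembly` are items carried as hypotheses
-- (`_hIso`, `_hTurn`, `_hA`); the logic does not consume them.
@[closes "route-CriticalPhenomena-SAWTensorRG"] theorem closes
    (hCA : ConformalAvoidance) (_hIso : IsotropicCorrelationLength)
    (hS : SimpleSubseqLimits) (hR : RestrictionOfLimit) (hT : EventualTight)
    (hAv : AvoidanceDeterminesLaw) (hE : EndpointApproxExists) (_hTurn : TurningInvariance)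
    (hG : LimitGlue) (hLSW : LSWCharacterisation) (_hA : Assembly) : _root_.SAWScalingLimit := by
  obtain ⟨P, hch, hlim, hconf⟩ :=
    hG Literature.Probability.RandomPlanarGeometry.CurveClass.polishSpace_holds
      Literature.Probability.RandomPlanarGeometry.MarkedDomain.exists_isChordalUniformizing_holds
      hE hCA hT hS hAv
  have hrestr := hR P hch hlim
  have hsimple : ∀ D : Literature.Probability.RandomPlanarGeometry.DobrushinDomain,
      ∀ᵐ γ ∂(P D), γ ∈ Literature.Probability.RandomPlanarGeometry.CurveClass.simple ∧
        γ.range ∩ frontier D.carrier ⊆ {D.pt 0, D.pt 1} := by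
    intro D
    obtain ⟨a, b, hab⟩ := hE D
    have hs : Filter.Tendsto (fun n : ℕ => (1 : ℝ) / ((n : ℝ) + 1)) Filter.atTop
        (nhdsWithin 0 (Set.Ioi 0)) :=
      tendsto_nhdsWithin_iff.2 ⟨tendsto_one_div_add_atTop_nhds_zero_nat,
        Filter.Eventually.of_forall fun n =>
          Set.mem_Ioi.2 (one_div_pos.2 (Nat.cast_add_one_pos n))⟩
    have hν : MeasureTheory.IsProbabilityMeasure (P D) := (hch D).1
    have hconv : ∀ f : BoundedContinuousFunction
        (Literature.Probability.RandomPlanarGeometry.CurveClass ℂ) ℝ,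
        Filter.Tendsto (fun n : ℕ => ∫ γ, f γ.curve
          ∂(Literature.Probability.RandomPlanarGeometry.SAW.law D.carrier ((1 : ℝ) / ((n : ℝ) + 1))
            (a ((1 : ℝ) / ((n : ℝ) + 1))) (b ((1 : ℝ) / ((n : ℝ) + 1)))))
          Filter.atTop (nhds (∫ x, f x ∂(P D))) :=
      fun f => (hlim D a b hab f).comp hs
    have hall := hS D a b hab (fun n : ℕ => (1 : ℝ) / ((n : ℝ) + 1)) (P D) hs hν hconv
    filter_upwards [hall] with γ hγ using ⟨hγ.1, hγ.2.2.2.2⟩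
  have hsle : ∀ D : Literature.Probability.RandomPlanarGeometry.DobrushinDomain,
      Literature.Probability.RandomPlanarGeometry.IsSLELaw ((8 : NNReal) / 3) D (P D) :=
    hLSW P hch hconf hrestr hsimple
  intro D a b hab
  obtain ⟨Γ, hΓ, hPD⟩ := hsle D
  refine ⟨Γ, hΓ, Filter.Eventually.of_forall fun δ =>
    Literature.Probability.RandomPlanarGeometry.SAW.aemeasurable_curve _ _ _ _, fun f => ?_⟩
  have h := hlim D a b hab f
  simp only [id_eq, hPD] at h
  rwa [MeasureTheory.integral_map hΓ.aemeasurable f.continuous.aestronglyMeasurable] at h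

end Summit.CriticalPhenomena.SAWScalingLimit.Theses.SAWTensorRG
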